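import Summits.BirchSwinnertonDyer.BirchSwinnertonDyer.Theorems.SemiOrdinaryEisensteinDescentWildSplitEisensteinValueAtOneVOwnPointDoor
import Summits.BirchSwinnertonDyer.Rank1Residual.GaloisImage.LocalTorsionExponentAdditiveThree
import Literature.NumberTheory.EllipticCurves.NeronComponentIndexTypeIVExact
import Literature.NumberTheory.EllipticCurves.NeronComponentIndexTypeIVstarExact
import Literature.NumberTheory.EllipticCurves.NeronComponentIndexProofs
import Literature.NumberTheory.EllipticCurves.VariableChangePointsMap
import Literature.NumberTheory.EllipticCurves.RootNumberTableThreeLocalReadingsProofs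
import Mathlib.NumberTheory.Padics.HeightOneSpectrum
import HarnessLib

/-!
# Route `SemiOrdinaryEisensteinDescent`, crux #2″ `WildSplitEisensteinValueAtOneV` (E_𝟙^V, stmt-BirchSwinnertonDyer-26610):
# the OWN POINT at the ADDITIVE prime `3` itself — `G₀ ∉ 3·E(ℚ₃)` from Tate's algorithm (`c₃ = 1`) and `3·E₀(ℚ₃) ⊆ E₁(ℚ₃)`
# (cell `pub/bsd-wall`, width seat `bsd-wall-soed-p1-w3` g23; `--supports stmt-BirchSwinnertonDyer-26610`; THEOREMS ONLY;
# Theses-free; cell-free)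

WHY. The Cassels–Tate-free visibility door `VisibleTwoWitnessOwnPoint.missingLowerBoundAt_rankOne_irr_of_two_witnesses_of_ownPoint`
(this seat, `…TwoWitnessOwnPointDoor.lean`) needs a SEPARATING place `v₀` where both partner witnesses are `p`-divisible and
a rational point `G₀` of `E` is NOT. On the strict content rows of crux #2″ the only place where TWO independent witnesses are
locally `3`-divisible is the paid place `v₀ = 3` (the kernel of `F(ℚ)/3 → F(ℚ₃)/3F(ℚ₃)` is `2`-dimensional there), and `3`
is a place of ADDITIVE reduction of `E` (the cell is wild at `3`), where w3 g21's reduction certificate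
(`VisibleOwnPoint.not_exists_smul_eq_baseChange_of_reductionCert`, GOOD primes only) is silent. This file supplies the
additive criterion:

* §1 `not_exists_three_nsmul_eq_of_cusp_of_top` — for an integral `ℤ₃`-model `I` whose reduction is a CUSP
  (`Δ̄ = c̄₄ = 0`) and whose points ALL have nonsingular reduction (`E(ℚ₃) = E₀(ℚ₃)`, i.e. `c₃ = 1` on this model), a point
  NOT reducing to `O` is not `3 • Q`: `3·E₀(ℚ₃) ⊆ E₁(ℚ₃)` because `E₀/E₁ ↪ Ẽ_ns(k̄) ≅ (k̄,+)` has exponent `3` (tree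
  `LocalTorsionExp3.reducesToZero_three_nsmul_of_mem`, Silverman AEC VII.2.1 + III.2.5).
* §2 `E(ℚ₃) = E₀(ℚ₃)` from Tate's algorithm on a NORMAL FORM with integer data, decided by `decide` on `ZMod 3`:
  type IV (`a₁, a₂ ∈ 𝔪`, `a₃ = 3γ`, `a₄ ∈ 𝔪²`, `a₆ = 9ε`, `Y² + γ̄Y − ε̄` rootless mod `3`; tree
  `LocalIndex.index_eq_one_of_forall_not_root_of_normalForm_IV`, Hensel-free), type IV* (`a₁ ∈ 𝔪`, `a₂ ∈ 𝔪²`, `a₃ = 9γ`,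
  `a₄ ∈ 𝔪³`, `a₆ = 81ε`, same quadratic; `…_normalForm_IVstar`), type II* (`3 ∣ a₁`, `9 ∣ a₂`, `27 ∣ a₃`, `81 ∣ a₄`,
  `243 ∣ a₆`, `729 ∤ a₆`; tree `LocalIndex.dvd_a₆_of_equation_IIstar`) — Silverman ATAEC IV.9.4 Steps 5, 8, 10 ("c = 1").
* §3 transport: along an integral change of variables `C` over `ℚ₃` with `C • (W ⊗ ℚ₃) = I ⊗ ℚ₃` (the tree's
  `VariableChange.pointEquiv` + `Affine.Point.congrEquiv`), and from `ℚ_[3]` to the completion `ℚ_v` at the place `v ∣ 3`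
  (Mathlib's `adicCompletion.padicEquiv`), landing LITERALLY in the door's binder
  `¬ ∃ Q : E(ℚ_v), 3 • Q = G₀|_{ℚ_v}` — `not_exists_three_nsmul_eq_baseChange_of_normalForm`.

HONEST FRAMING: tool theorems; per curve they need the normal form and the point as INPUTS (decided by `decide`/`norm_num`
in the row files); nothing is booked; the crux stays research-open class-wide; BSD is not proved by any of this.

References: [SilvermanAEC2009] VII.2.1, III.2.5; [SilvermanATAEC1994] IV.9.4 Steps 5, 8, 10 and Table 4.1; [Tate1975] §7.
-/

set_option autoImplicit false
set_option linter.dupNamespace false -- the Theorems namespace repeats the summit name by design (D-0017 nested layout)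

noncomputable section

open scoped Classical

open WeierstrassCurve IsLocalRing Literature.NumberTheory.EllipticCurves
open NumberField IsDedekindDomain Rat.HeightOneSpectrum
open Summit.BirchSwinnertonDyer.Rank1Residual.GaloisImage

namespace Summit.BirchSwinnertonDyer.BirchSwinnertonDyer.Theorems.AdditiveOwnPointAtThree

/-! ## §1 The cusp criterion: `E(ℚ₃) = E₀(ℚ₃)` and additive reduction ⟹ an integral point is not `3`-divisible -/

/-- **`G₀ ∉ 3·E(ℚ₃)` at an ADDITIVE place with `c₃ = 1`.** For a `ℤ₃`-integral equation `I` whose reduction is a cusp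
(`Δ̄ = 0`, `c̄₄ = 0`) and ALL of whose `ℚ₃`-points have nonsingular reduction (`E₀(ℚ₃) = E(ℚ₃)`), a point `P` that does
NOT reduce to `O` is not of the form `3 • Q`: otherwise `P = 3 • Q ∈ 3·E₀(ℚ₃) ⊆ E₁(ℚ₃)`
(`LocalTorsionExp3.reducesToZero_three_nsmul_of_mem`: the reduction homomorphism lands in `Ẽ_ns(k̄) ≅ (k̄, +)`, killed by `3`).
[cite: SilvermanAEC2009, VII.2 Prop. 2.1 and III.2.5 (PDF pp. 167, 56)] -/
theorem not_exists_three_nsmul_eq_of_cusp_of_top (I : WeierstrassCurve ℤ_[3])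
    (hΔ : residue ℤ_[3] I.Δ = 0) (hc₄ : residue ℤ_[3] I.c₄ = 0)
    (htop : I.nonsingularReductionSubgroup (integers_valuationRing_valuation ℤ_[3] ℚ_[3]) = ⊤)
    {P : (I.baseChange ℚ_[3]).toAffine.Point} (hP : ¬ I.ReducesToZero P) :
    ¬ ∃ Q : (I.baseChange ℚ_[3]).toAffine.Point, 3 • Q = P := by
  rintro ⟨Q, rfl⟩
  exact hP (LocalTorsionExp3.reducesToZero_three_nsmul_of_mem I hΔ hc₄ (htop ▸ AddSubgroup.mem_top Q))

/-! ## §2 `E(ℚ₃) = E₀(ℚ₃)` from a Tate normal form with integer data -/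

/-- `ResidueField ℤ_[3] ≃ 𝔽₃`: a quadratic `Y² + γ̄Y − ε̄` with INTEGER `γ, ε` has no root in the residue field of `ℤ₃`
as soon as it has none in `ZMod 3` (decidable). [folklore] -/
theorem forall_residue_quadratic_ne_zero (γ ε : ℤ)
    (h : ∀ z : ZMod 3, z ^ 2 + (γ : ZMod 3) * z - (ε : ZMod 3) ≠ 0) :
    ∀ r : ResidueField ℤ_[3], r ^ 2 + residue ℤ_[3] (γ : ℤ_[3]) * r - residue ℤ_[3] (ε : ℤ_[3]) ≠ 0 := by
  intro r hr
  have key : ∀ n : ℤ, PadicInt.residueField (residue ℤ_[3] (n : ℤ_[3])) = (n : ZMod 3) := by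
    intro n
    rw [map_intCast, map_intCast]
  apply h (PadicInt.residueField r)
  have h' := congrArg (PadicInt.residueField (p := 3)) hr
  rw [map_sub, map_add, map_mul, map_pow, key, key, map_zero] at h'
  exact h'

/-- `3` generates the maximal ideal of `ℤ₃`: `3 ∣ a ↔ a ∈ 𝔪`. [folklore] -/
theorem mem_maximalIdeal_of_three_dvd {a : ℤ_[3]} (h : (3 : ℤ_[3]) ∣ a) : a ∈ maximalIdeal ℤ_[3] := by
  rw [PadicInt.maximalIdeal_eq_span_p, Ideal.mem_span_singleton]
  exact_mod_cast h

/-- `3^k ∣ a ⟹ a ∈ 𝔪^k` in `ℤ₃`. [folklore] -/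
theorem mem_maximalIdeal_pow_of_pow_dvd {a : ℤ_[3]} {k : ℕ} (h : (3 : ℤ_[3]) ^ k ∣ a) :
    a ∈ maximalIdeal ℤ_[3] ^ k := by
  rw [PadicInt.maximalIdeal_eq_span_p, Ideal.span_singleton_pow, Ideal.mem_span_singleton]
  exact_mod_cast h

/-- **Type IV with `c₃ = 1`: every `ℚ₃`-point has nonsingular reduction.** For a `ℤ₃`-equation in the type-IV normal form
(`3 ∣ a₁`, `3 ∣ a₂`, `a₃ = 3γ`, `9 ∣ a₄`, `a₆ = 9ε`) whose Step-5 quadratic `Y² + γ̄Y − ε̄` has no root in `𝔽₃`,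
`E₀(ℚ₃) = E(ℚ₃)` (Silverman ATAEC IV.9.4 Step 5: "c = 1 if k' ≠ k"; tree `LocalIndex.index_eq_one_of_forall_not_root_of_normalForm_IV`,
Hensel-free). [cite: SilvermanATAEC1994, IV.9.4 Step 5 (PDF p. 344)] -/
theorem nonsingularReductionSubgroup_eq_top_of_normalForm_IV (I : WeierstrassCurve ℤ_[3])
    (h1 : (3 : ℤ_[3]) ∣ I.a₁) (h2 : (3 : ℤ_[3]) ∣ I.a₂) (γ ε : ℤ) (hγ : I.a₃ = 3 * (γ : ℤ_[3]))
    (h4 : (3 : ℤ_[3]) ^ 2 ∣ I.a₄) (hε : I.a₆ = 3 ^ 2 * (ε : ℤ_[3]))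
    (hno : ∀ z : ZMod 3, z ^ 2 + (γ : ZMod 3) * z - (ε : ZMod 3) ≠ 0) :
    I.nonsingularReductionSubgroup (integers_valuationRing_valuation ℤ_[3] ℚ_[3]) = ⊤ := by
  rw [← AddSubgroup.index_eq_one]
  exact LocalIndex.index_eq_one_of_forall_not_root_of_normalForm_IV (K := ℚ_[3]) I (mem_maximalIdeal_of_three_dvd h1)
    (mem_maximalIdeal_of_three_dvd h2) Rizzo.irreducible_three_padicInt hγ (mem_maximalIdeal_pow_of_pow_dvd h4) hε
    (forall_residue_quadratic_ne_zero γ ε hno)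

/-- **Type IV* with `c₃ = 1`: every `ℚ₃`-point has nonsingular reduction.** Normal form `3 ∣ a₁`, `9 ∣ a₂`, `a₃ = 9γ`,
`27 ∣ a₄`, `a₆ = 81ε`, Step-8 quadratic `Y² + γ̄Y − ε̄` rootless in `𝔽₃` (Silverman ATAEC IV.9.4 Step 8: "c = 1 if
k' ≠ k"; tree `LocalIndex.index_eq_one_of_forall_not_root_of_normalForm_IVstar`, Hensel-free).
[cite: SilvermanATAEC1994, IV.9.4 Step 8 (PDF p. 346)] -/
theorem nonsingularReductionSubgroup_eq_top_of_normalForm_IVstar (I : WeierstrassCurve ℤ_[3])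
    (h1 : (3 : ℤ_[3]) ∣ I.a₁) (h2 : (3 : ℤ_[3]) ^ 2 ∣ I.a₂) (γ ε : ℤ) (hγ : I.a₃ = 3 ^ 2 * (γ : ℤ_[3]))
    (h4 : (3 : ℤ_[3]) ^ 3 ∣ I.a₄) (hε : I.a₆ = 3 ^ 4 * (ε : ℤ_[3]))
    (hno : ∀ z : ZMod 3, z ^ 2 + (γ : ZMod 3) * z - (ε : ZMod 3) ≠ 0) :
    I.nonsingularReductionSubgroup (integers_valuationRing_valuation ℤ_[3] ℚ_[3]) = ⊤ := by
  rw [← AddSubgroup.index_eq_one]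
  exact LocalIndex.index_eq_one_of_forall_not_root_of_normalForm_IVstar (K := ℚ_[3]) I (mem_maximalIdeal_of_three_dvd h1)
    (mem_maximalIdeal_pow_of_pow_dvd h2) Rizzo.irreducible_three_padicInt hγ (mem_maximalIdeal_pow_of_pow_dvd h4) hε
    (forall_residue_quadratic_ne_zero γ ε hno)

/-- **Type II* (`c₃ = 1` always): every `ℚ₃`-point has nonsingular reduction.** Normal form `3 ∣ a₁`, `9 ∣ a₂`, `27 ∣ a₃`,
`81 ∣ a₄`, `243 ∣ a₆`, `729 ∤ a₆`: a point reducing to the cusp `(0,0)` would force `3⁶ ∣ a₆` (tree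
`LocalIndex.dvd_a₆_of_equation_IIstar`; Silverman ATAEC IV.9.4 Step 10: "c = 1").
[cite: SilvermanATAEC1994, IV.9.4 Step 10 (PDF p. 346)] -/
theorem nonsingularReductionSubgroup_eq_top_of_normalForm_IIstar (I : WeierstrassCurve ℤ_[3])
    (h1 : (3 : ℤ_[3]) ∣ I.a₁) (h2 : (3 : ℤ_[3]) ^ 2 ∣ I.a₂) (h3 : (3 : ℤ_[3]) ^ 3 ∣ I.a₃)
    (h4 : (3 : ℤ_[3]) ^ 4 ∣ I.a₄) (h6 : (3 : ℤ_[3]) ^ 5 ∣ I.a₆) (h6' : ¬ (3 : ℤ_[3]) ^ 6 ∣ I.a₆) :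
    I.nonsingularReductionSubgroup (integers_valuationRing_valuation ℤ_[3] ℚ_[3]) = ⊤ := by
  rw [eq_top_iff]
  intro P _
  rw [WeierstrassCurve.mem_nonsingularReductionSubgroup_iff]
  rcases point_cases (integers_valuationRing_valuation ℤ_[3] ℚ_[3]) P with rfl | ⟨x, y, h, rfl, hx⟩ | ⟨a, b, h, rfl⟩
  · trivial
  · exact Or.inl ((not_mem_range_iff (integers_valuationRing_valuation ℤ_[3] ℚ_[3])).mpr hx)
  · refine (WeierstrassCurve.hasNonsingularReduction_some_algebraMap_iff (IsFractionRing.injective ℤ_[3] ℚ_[3]) h).mpr ?_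
    by_contra hns
    have he : I.toAffine.Equation a b :=
      (WeierstrassCurve.Affine.map_equation _ (IsFractionRing.injective ℤ_[3] ℚ_[3]) a b).mp h.left
    have h3m : I.a₃ ∈ maximalIdeal ℤ_[3] := mem_maximalIdeal_of_three_dvd ((dvd_pow_self 3 (by norm_num)).trans h3)
    have h4m : I.a₄ ∈ maximalIdeal ℤ_[3] := mem_maximalIdeal_of_three_dvd ((dvd_pow_self 3 (by norm_num)).trans h4)
    have h6m : I.a₆ ∈ maximalIdeal ℤ_[3] := mem_maximalIdeal_of_three_dvd ((dvd_pow_self 3 (by norm_num)).trans h6)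
    obtain ⟨ha, hb⟩ := LocalIndex.mem_maximalIdeal_of_not_nonsingular h3m h4m h6m he hns
    rw [PadicInt.maximalIdeal_eq_span_p, Ideal.mem_span_singleton] at ha hb
    exact h6' (LocalIndex.dvd_a₆_of_equation_IIstar Rizzo.irreducible_three_padicInt h1 h2 h3 h4 h6 he
      (by exact_mod_cast ha) (by exact_mod_cast hb))

/-! ## §3 Transport: along an integral change of variables over `ℚ₃`, and from `ℚ_[3]` to the completion `ℚ_v`, `v ∣ 3` -/

/-- **Divisibility by `n` is transported along a change of variables** (`VariableChange.pointEquiv` is additive) and along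
an equality of equations (`Affine.Point.congrEquiv`). [cite: SilvermanAEC2009, III.3.1(b)] -/
theorem exists_nsmul_eq_congr_pointEquiv_of_exists {F : Type} [Field F] (X : WeierstrassCurve F)
    (C : VariableChange F) {Y : WeierstrassCurve F} (hC : C • X = Y) (n : ℕ) {P : X.toAffine.Point}
    (h : ∃ Q : X.toAffine.Point, n • Q = P) :
    ∃ Q : Y.toAffine.Point, n • Q = Affine.Point.congrEquiv hC (VariableChange.pointEquiv X C P) := by
  obtain ⟨Q, rfl⟩ := h
  exact ⟨Affine.Point.congrEquiv hC (VariableChange.pointEquiv X C Q), by rw [map_nsmul, map_nsmul]⟩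

/-- **From `ℚ_v` (`v` the place of `ℚ` above `ℓ`) to `ℚ_[ℓ]`**: if `G₀|_{ℚ_v} = n • Q` in `E(ℚ_v)` then
`G₀|_{ℚ_[ℓ]} = n • Q'` in `E(ℚ_[ℓ])` — transport along Mathlib's continuous `ℚ`-algebra isomorphism
`adicCompletion.padicEquiv v : ℚ_v ≃A[ℚ] ℚ_[ℓ]` (`Affine.Point.map` along it is additive, `Affine.Point.map_baseChange`).
The shape of w3 g21's `VisibleOwnPoint.not_exists_smul_eq_baseChange_of_reductionCert`, model-free. [folklore] -/
theorem not_exists_nsmul_eq_baseChange_of_padic (W : WeierstrassCurve ℚ) {n : ℕ} (ℓ : ℕ) [Fact ℓ.Prime]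
    {v : HeightOneSpectrum (𝓞 ℚ)} (hv : (primesEquiv v : ℕ) = ℓ) (G₀ : W.toAffine.Point)
    (h : ¬ ∃ Q : (W.baseChange ℚ_[ℓ]).toAffine.Point,
      n • Q = WeierstrassCurve.Affine.Point.baseChange (W' := W) ℚ ℚ_[ℓ] G₀) :
    ¬ ∃ Q : (W.baseChange (v.adicCompletion ℚ)).toAffine.Point,
      n • Q = WeierstrassCurve.Affine.Point.baseChange (W' := W) ℚ (v.adicCompletion ℚ) G₀ := by
  subst hv
  rintro ⟨Q, hQ⟩
  let ψ : v.adicCompletion ℚ →ₐ[ℚ] ℚ_[(primesEquiv v : ℕ)] :=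
    ((adicCompletion.padicEquiv v) : v.adicCompletion ℚ ≃A[ℚ] ℚ_[(primesEquiv v : ℕ)])
  refine h ⟨WeierstrassCurve.Affine.Point.map (W' := W) ψ Q, ?_⟩
  rw [← map_nsmul, hQ, WeierstrassCurve.Affine.Point.map_baseChange]

/-- **The assembled own-point criterion at the additive prime `3`, in the door's currency.** `W` over `ℚ`, `I` a
`ℤ₃`-integral equation with cuspidal reduction and `E₀ = E` (§2), `C` a change of variables over `ℚ₃` with
`C • (W ⊗ ℚ₃) = I ⊗ ℚ₃`, and `G₀ ∈ W(ℚ)` whose image on `I` does not reduce to `O`: then `G₀ ∉ 3·W(ℚ_v)` at the place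
`v ∣ 3`. [cite: SilvermanAEC2009, VII.2 Prop. 2.1 and III.3.1(b)] -/
theorem not_exists_three_nsmul_eq_baseChange_of_normalForm (W : WeierstrassCurve ℚ) (I : WeierstrassCurve ℤ_[3])
    (hΔ : residue ℤ_[3] I.Δ = 0) (hc₄ : residue ℤ_[3] I.c₄ = 0) (htop : I.nonsingularReductionSubgroup (integers_valuationRing_valuation ℤ_[3] ℚ_[3]) = ⊤)
    (C : VariableChange ℚ_[3]) (hC : C • W.baseChange ℚ_[3] = I.baseChange ℚ_[3])
    (G₀ : W.toAffine.Point)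
    (hP : ¬ I.ReducesToZero (Affine.Point.congrEquiv hC (VariableChange.pointEquiv (W.baseChange ℚ_[3]) C
      (WeierstrassCurve.Affine.Point.baseChange (W' := W) ℚ ℚ_[3] G₀))))
    {v : HeightOneSpectrum (𝓞 ℚ)} (hv : (primesEquiv v : ℕ) = 3) :
    ¬ ∃ Q : (W.baseChange (v.adicCompletion ℚ)).toAffine.Point,
      3 • Q = WeierstrassCurve.Affine.Point.baseChange (W' := W) ℚ (v.adicCompletion ℚ) G₀ := by
  haveI : Fact (Nat.Prime 3) := ⟨Nat.prime_three⟩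
  refine not_exists_nsmul_eq_baseChange_of_padic W 3 hv G₀ fun h ↦ ?_
  exact not_exists_three_nsmul_eq_of_cusp_of_top I hΔ hc₄ htop hP
    (exists_nsmul_eq_congr_pointEquiv_of_exists (W.baseChange ℚ_[3]) C hC 3 h)

/-- **Reading the image point**: for an AFFINE rational point `G₀ = (x, y)` and a change of variables `C = (u; r, s, t)`,
the transported point on `I ⊗ ℚ₃` is affine with `x`-coordinate `u⁻²(x − r)`; it does not reduce to `O` iff that
coordinate lies in `ℤ₃`. [cite: SilvermanAEC2009, III.1 Table 3.1 and VII.2 (PDF p. 167)] -/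
theorem not_reducesToZero_congr_pointEquiv_some (W : WeierstrassCurve ℚ) (I : WeierstrassCurve ℤ_[3])
    (C : VariableChange ℚ_[3]) (hC : C • W.baseChange ℚ_[3] = I.baseChange ℚ_[3])
    {x y : ℚ} (h : W.toAffine.Nonsingular x y)
    (hx : C.toX (x : ℚ_[3]) ∈ Set.range (algebraMap ℤ_[3] ℚ_[3])) :
    ¬ I.ReducesToZero (Affine.Point.congrEquiv hC (VariableChange.pointEquiv (W.baseChange ℚ_[3]) C
      (WeierstrassCurve.Affine.Point.baseChange (W' := W) ℚ ℚ_[3] (.some x y h)))) := by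
  rw [show WeierstrassCurve.Affine.Point.baseChange (W' := W) ℚ ℚ_[3] =
      WeierstrassCurve.Affine.Point.map (W' := W) (Algebra.ofId ℚ ℚ_[3]) from rfl,
    WeierstrassCurve.Affine.Point.map_some, VariableChange.pointEquiv_some, Affine.Point.congrEquiv_some,
    reducesToZero_some_iff]
  intro hnot
  apply hnot
  have hx' := hx
  rw [← eq_ratCast (algebraMap ℚ ℚ_[3]) x] at hx'
  exact hx'

end Summit.BirchSwinnertonDyer.BirchSwinnertonDyer.Theorems.AdditiveOwnPointAtThree

end
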